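import Literature.MathematicalPhysics.KineticTheory.BackwardCluster
import HarnessLib

/-!
# Backward clusters along the hard-sphere flow are measurable

`Literature.MathematicalPhysics.KineticTheory.BackwardCluster` defines the backward cluster
`Φ.backwardCluster i s t z` and the recollision count `Φ.recollisionCount i s t z` of a tagged
particle `i` over a time window `(s, t]` as functions of the initial datum `z` of a hard-sphere
flow `Φ : HardSphereFlow G ε N` (Aoki–Pulvirenti–Simonella–Tsuji 2015 §1, §5;
Pulvirenti–Simonella 2021 §1.1). This file proves that these are **measurable** functions of
the initial datum, for an *arbitrary* hard-sphere flow (only the structure fields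
`measurable_flow`, `isTrajectory`, `measurableSet_good` are used), so that the laws
`P(|BC| = k)`, the means `⟨K⟩_t = Φ.meanBackwardClusterCard P₀ i 0 t` and the expected number
of recollisions are well-defined integrals against any initial law.

## The argument (velocity sampling)

A `HardSphereFlow` only provides measurability of each time-`t` map `z ↦ Φ_t z`, not of the
collision times as functions of `z`. We therefore read the collision record off finitely many
time samples: on the dyadic grid of level `n` of `[s, t]` we record, for each cell, the set of
particles whose velocity differs at the two ends of the cell (`velChanged`), and form the
*detected event* — the unordered pairs of distinct such particles (`detectedEvent`,
`dyadicEvents`). Along a hard-sphere trajectory the collision times in `(s, t]` are finitely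
many, hence separated by a positive gap; once the mesh is below the gap every cell contains at
most one collision, a collision-free cell detects nothing (free flight keeps the velocities,
`IsHardSphereTrajectory.vel_eq_of_free`) and a cell with one collision of the pair `{p, q}`
detects exactly `{p, q}` (an incoming elastic reflection changes both velocities and no other,
`IsHardSphereTrajectory.vel_ne_iff_of_collision`). Hence the nonempty detected events, in
order, are the collision events (`IsHardSphereTrajectory.dyadicEvents_filter_eq`), the sampled
sweep is eventually the backward sweep (`IsHardSphereTrajectory.eventually_dyadicSweep_eq`),
and each sampled sweep is a function of finitely many measurable velocity comparisons
(`HardSphereFlow.measurableSet_dyadicSweep_fiber`). Eventual values of such functions are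
measurable.

## Main results

* `HardSphereFlow.measurableSet_backwardCluster_eq` — `{z | Φ.backwardCluster i s t z = A}` is
  measurable for every `A`; `HardSphereFlow.measurableSet_mem_backwardCluster`;
* `HardSphereFlow.measurable_card_backwardCluster` — `z ↦ |BC|` is measurable, and
  `HardSphereFlow.integrable_card_backwardCluster` — integrable under any finite initial law;
* `HardSphereFlow.measurable_recollisionCount` — the recollision count is measurable.

## References

* K. Aoki, M. Pulvirenti, S. Simonella, T. Tsuji, *Backward clusters, hierarchy and wild sums
  for a hard sphere system in a low-density regime*, M3AS 25 (2015), §1, §5.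
* M. Pulvirenti, S. Simonella, *On the cardinality of collisional clusters for hard spheres at
  low density*, DCDS 41 (2021), §1.1.
-/

open Set Filter
open _root_.MeasureTheory
open _root_.Topology
open scoped InnerProductSpace

namespace Literature.MathematicalPhysics.KineticTheory

noncomputable section

open Literature.Analysis.FluidPDE

variable {d : Type*} [Fintype d] {X : Type*} {N : ℕ}

/-! ## Velocities along a hard-sphere trajectory -/

section Reflect

variable {E : Type*} [NormedAddCommGroup E] [InnerProductSpace ℝ E]

/-- An elastic reflection with incoming velocities changes both velocities. [folklore] -/
theorem reflectVel_ne_of_inner_neg {n v w : E} (h : ⟪n, v - w⟫_ℝ < 0) :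
    (reflectVel n (v, w)).1 ≠ v ∧ (reflectVel n (v, w)).2 ≠ w := by
  have hn : n ≠ 0 := by
    rintro rfl
    rw [inner_zero_left] at h
    exact lt_irrefl _ h
  have hc : ⟪v - w, n⟫_ℝ / ‖n‖ ^ 2 ≠ 0 :=
    div_ne_zero (fun h0 => h.ne (inner_eq_zero_symm.1 h0)) (pow_ne_zero 2 (norm_ne_zero_iff.2 hn))
  have hcn : (⟪v - w, n⟫_ℝ / ‖n‖ ^ 2) • n ≠ 0 := smul_ne_zero hc hn
  simp only [reflectVel]
  exact ⟨fun h' => hcn (sub_eq_self.1 h'), fun h' => hcn (add_eq_left.1 h')⟩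

end Reflect

section Velocities

variable {G : Geometry d X} {ε : ℝ}

/-- In a collision from an incoming configuration the velocity of the first particle of the
pair changes. [folklore] -/
theorem vel_collidePair_left_ne {z : Config N d X} {p q : Fin N} (hpq : p ≠ q)
    (hin : IsIncoming G z p q) : (collidePair G p q z p).2 ≠ (z p).2 := by
  rw [collidePair_apply_left hpq]
  exact (reflectVel_ne_of_inner_neg hin).1

/-- In a collision from an incoming configuration the velocity of the second particle of the
pair changes. [folklore] -/
theorem vel_collidePair_right_ne {z : Config N d X} {p q : Fin N}
    (hin : IsIncoming G z p q) : (collidePair G p q z q).2 ≠ (z q).2 := by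
  rw [collidePair_apply_right]
  exact (reflectVel_ne_of_inner_neg hin).2

variable [TopologicalSpace X] {γ : ℝ → Config N d X}

/-- On a collision-free stretch `(a, b]` of a hard-sphere trajectory the velocities do not
change (free flight). [folklore] -/
theorem _root_.Literature.Analysis.FluidPDE.IsHardSphereTrajectory.vel_eq_of_free
    (h : IsHardSphereTrajectory G ε N γ) {a b : ℝ} (hab : a ≤ b)
    (hfree : ∀ τ ∈ Ioc a b, τ ∉ collisionTimes G ε γ) (j : Fin N) :
    (γ b j).2 = (γ a j).2 := by
  rw [h.free a b hab hfree, freeFlight_apply]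

/-- If `(a, τ)` is collision-free, the velocities of the left limit at `τ` are those at time
`a`. [folklore] -/
theorem _root_.Literature.Analysis.FluidPDE.IsHardSphereTrajectory.vel_eq_of_tendsto
    (h : IsHardSphereTrajectory G ε N γ) {a τ : ℝ} (haτ : a < τ)
    (hfree : ∀ σ ∈ Ioo a τ, σ ∉ collisionTimes G ε γ) {zl : Config N d X}
    (hzl : Tendsto γ (𝓝[<] τ) (𝓝 zl)) (j : Fin N) : (zl j).2 = (γ a j).2 := by
  have hev : Continuous fun z : Config N d X => (z j).2 := (continuous_apply j).snd
  have h1 : Tendsto (fun u => (γ u j).2) (𝓝[<] τ) (𝓝 (zl j).2) := (hev.tendsto zl).comp hzl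
  have h2 : Tendsto (fun u => (γ u j).2) (𝓝[<] τ) (𝓝 (γ a j).2) := by
    refine tendsto_const_nhds.congr' ?_
    filter_upwards [Ioo_mem_nhdsLT haτ] with u hu
    rw [h.free a u hu.1.le fun σ hσ => hfree σ ⟨hσ.1, hσ.2.trans_lt hu.2⟩, freeFlight_apply]
  exact tendsto_nhds_unique h1 h2

/-- **One collision in a cell.** If `(a, b]` contains exactly one collision time `τ` of a
hard-sphere trajectory, at which the pair `{p, q}` collides, then between the times `a` and
`b` exactly the velocities of `p` and `q` change. [folklore] -/
theorem _root_.Literature.Analysis.FluidPDE.IsHardSphereTrajectory.vel_ne_iff_of_collision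
    (h : IsHardSphereTrajectory G ε N γ) {a b τ : ℝ} (haτ : a < τ) (hτb : τ ≤ b)
    (hfree₁ : ∀ σ ∈ Ioo a τ, σ ∉ collisionTimes G ε γ)
    (hfree₂ : ∀ σ ∈ Ioc τ b, σ ∉ collisionTimes G ε γ) {p q : Fin N} (hpq : p ≠ q)
    (hc : γ τ ∈ contactSet G N ε p q) (j : Fin N) :
    (γ a j).2 ≠ (γ b j).2 ↔ j = p ∨ j = q := by
  obtain ⟨-, zl, hzl, hin, heq⟩ := h.binary τ p q hpq hc
  rw [h.vel_eq_of_free hτb hfree₂ j, heq, ← h.vel_eq_of_tendsto haτ hfree₁ hzl j]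
  constructor
  · intro hne
    by_contra hj
    simp only [not_or] at hj
    exact hne (by rw [collidePair_apply_of_ne hj.1 hj.2])
  · rintro (rfl | rfl)
    · exact (vel_collidePair_left_ne hpq hin).symm
    · exact (vel_collidePair_right_ne hin).symm

/-- **No collision in a cell.** On a collision-free cell `(a, b]` no velocity changes. [folklore] -/
theorem _root_.Literature.Analysis.FluidPDE.IsHardSphereTrajectory.vel_eq_of_free'
    (h : IsHardSphereTrajectory G ε N γ) {a b : ℝ} (hab : a ≤ b)
    (hfree : ∀ τ ∈ Ioc a b, τ ∉ collisionTimes G ε γ) (j : Fin N) :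
    (γ a j).2 = (γ b j).2 :=
  (h.vel_eq_of_free hab hfree j).symm

end Velocities

/-! ## Dyadic grids -/

section Dyadic

/-- The `k`-th point of the level-`n` dyadic subdivision of `[s, t]`:
`s + k (t - s) / 2 ^ n`. [folklore] -/
def dyadicSamplePt (s t : ℝ) (n k : ℕ) : ℝ := s + (t - s) / 2 ^ n * k

variable {s t : ℝ} {n : ℕ}

/-- The dyadic grid starts at `s`. [folklore] -/
@[simp]
theorem dyadicSamplePt_zero : dyadicSamplePt s t n 0 = s := by simp [dyadicSamplePt]

/-- Consecutive grid points differ by the mesh `(t - s) / 2 ^ n`. [folklore] -/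
theorem dyadicSamplePt_succ (k : ℕ) :
    dyadicSamplePt s t n (k + 1) = dyadicSamplePt s t n k + (t - s) / 2 ^ n := by
  rw [dyadicSamplePt, dyadicSamplePt, Nat.cast_succ]
  ring

/-- The dyadic grid ends at `t`. [folklore] -/
@[simp]
theorem dyadicSamplePt_two_pow : dyadicSamplePt s t n (2 ^ n) = t := by
  rw [dyadicSamplePt, Nat.cast_pow, Nat.cast_ofNat, div_mul_cancel₀ _ (pow_ne_zero n two_ne_zero)]
  ring

/-- The dyadic grid is monotone (for `s ≤ t`). [folklore] -/
theorem dyadicSamplePt_mono (hst : s ≤ t) {k l : ℕ} (hkl : k ≤ l) :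
    dyadicSamplePt s t n k ≤ dyadicSamplePt s t n l := by
  unfold dyadicSamplePt
  have h0 : 0 ≤ (t - s) / 2 ^ n := div_nonneg (sub_nonneg.2 hst) (pow_nonneg zero_le_two n)
  have := mul_le_mul_of_nonneg_left (Nat.cast_le.2 hkl : (k : ℝ) ≤ l) h0
  linarith

/-- Grid points lie to the right of `s` (for `s ≤ t`). [folklore] -/
theorem le_dyadicSamplePt (hst : s ≤ t) (k : ℕ) : s ≤ dyadicSamplePt s t n k := by
  simpa using dyadicSamplePt_mono (n := n) hst (Nat.zero_le k)

/-- Grid points with index at most `2 ^ n` lie to the left of `t` (for `s ≤ t`). [folklore] -/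
theorem dyadicSamplePt_le (hst : s ≤ t) {k : ℕ} (hk : k ≤ 2 ^ n) : dyadicSamplePt s t n k ≤ t := by
  simpa using dyadicSamplePt_mono (n := n) hst hk

/-- Two points of a half-open cell of length `m` are at distance less than `m`. [folklore] -/
theorem abs_sub_lt_of_mem_Ioc {a m τ τ' : ℝ} (hτ : τ ∈ Ioc a (a + m)) (hτ' : τ' ∈ Ioc a (a + m)) :
    |τ - τ'| < m := by
  rw [abs_sub_lt_iff]
  constructor <;> linarith [hτ.1, hτ.2, hτ'.1, hτ'.2]

/-- Every time of `(s, t]` lies in one of the `2 ^ n` dyadic cells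
`(s + k (t-s)/2^n, s + (k+1) (t-s)/2^n]`. [folklore] -/
theorem exists_mem_Ioc_dyadicSamplePt (hst : s < t) {τ : ℝ} (hτ : τ ∈ Ioc s t) (n : ℕ) :
    ∃ k < 2 ^ n, τ ∈ Ioc (dyadicSamplePt s t n k) (dyadicSamplePt s t n (k + 1)) := by
  set m : ℝ := (t - s) / 2 ^ n with hm
  have hm0 : 0 < m := div_pos (sub_pos.2 hst) (pow_pos two_pos n)
  set x : ℝ := (τ - s) / m with hx
  have hx0 : 0 < x := div_pos (sub_pos.2 hτ.1) hm0
  have hτs : τ - s = m * x := by rw [hx, mul_div_cancel₀ _ hm0.ne']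
  have htm : t - s = m * 2 ^ n := by rw [hm, div_mul_cancel₀ _ (pow_ne_zero n two_ne_zero)]
  have hxle : x ≤ ((2 ^ n : ℕ) : ℝ) := by
    rw [Nat.cast_pow, Nat.cast_ofNat]
    have : m * x ≤ m * 2 ^ n := by rw [← hτs, ← htm]; linarith [hτ.2]
    exact le_of_mul_le_mul_left this hm0
  have hc0 : 0 < ⌈x⌉₊ := Nat.ceil_pos.2 hx0
  refine ⟨⌈x⌉₊ - 1, ?_, ?_, ?_⟩
  · have := Nat.ceil_le.2 hxle
    omega
  · -- left end: s + m (⌈x⌉ - 1) < τ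
    have h1 : ((⌈x⌉₊ - 1 : ℕ) : ℝ) = ⌈x⌉₊ - 1 := by rw [Nat.cast_sub hc0, Nat.cast_one]
    have h2 : (⌈x⌉₊ : ℝ) < x + 1 := Nat.ceil_lt_add_one hx0.le
    have h3 : m * (⌈x⌉₊ - 1 : ℝ) < m * x := mul_lt_mul_of_pos_left (by linarith) hm0
    change s + m * ((⌈x⌉₊ - 1 : ℕ) : ℝ) < τ
    rw [h1]
    linarith
  · -- right end: τ ≤ s + m ⌈x⌉
    have h1 : ((⌈x⌉₊ - 1 + 1 : ℕ) : ℝ) = ⌈x⌉₊ := by rw [Nat.sub_add_cancel hc0]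
    have h2 : x ≤ ⌈x⌉₊ := Nat.le_ceil x
    have h3 : m * x ≤ m * ⌈x⌉₊ := mul_le_mul_of_nonneg_left h2 hm0.le
    change τ ≤ s + m * ((⌈x⌉₊ - 1 + 1 : ℕ) : ℝ)
    rw [h1]
    linarith

end Dyadic

/-! ## Velocity sampling: detected events -/

section Detect

open scoped Classical in
/-- The particles whose velocities differ in the two configurations `z`, `z'`. [folklore] -/
def velChanged (z z' : Config N d X) : Finset (Fin N) :=
  Finset.univ.filter fun j => (z j).2 ≠ (z' j).2

open scoped Classical in
/-- The unordered pairs of distinct particles of `D`. [folklore] -/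
def distinctPairs (D : Finset (Fin N)) : Finset (Sym2 (Fin N)) :=
  Finset.univ.filter fun e => ¬ e.IsDiag ∧ ∀ j ∈ e, j ∈ D

/-- Membership in `velChanged`. [folklore] -/
theorem mem_velChanged {z z' : Config N d X} {j : Fin N} :
    j ∈ velChanged z z' ↔ (z j).2 ≠ (z' j).2 := by
  classical
  simp [velChanged]

/-- Membership in `distinctPairs`. [folklore] -/
theorem mk_mem_distinctPairs {D : Finset (Fin N)} {j k : Fin N} :
    s(j, k) ∈ distinctPairs D ↔ j ≠ k ∧ j ∈ D ∧ k ∈ D := by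
  classical
  simp [distinctPairs, Sym2.mk_isDiag_iff, Sym2.mem_iff]

/-- No particle, no pair. [folklore] -/
@[simp]
theorem distinctPairs_empty : distinctPairs (∅ : Finset (Fin N)) = ∅ := by
  refine Finset.eq_empty_of_forall_notMem fun e => ?_
  induction e using Sym2.ind with
  | h j k => exact fun he => Finset.notMem_empty j (mk_mem_distinctPairs.1 he).2.1

/-- Two distinct particles form exactly one pair. [folklore] -/
theorem distinctPairs_pair {p q : Fin N} (hpq : p ≠ q) :
    distinctPairs ({p, q} : Finset (Fin N)) = {s(p, q)} := by
  ext e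
  induction e using Sym2.ind with
  | h j k =>
    rw [mk_mem_distinctPairs, Finset.mem_singleton, Finset.mem_insert, Finset.mem_singleton,
      Finset.mem_insert, Finset.mem_singleton, Sym2.eq_iff]
    constructor
    · rintro ⟨hjk, rfl | rfl, rfl | rfl⟩
      · exact absurd rfl hjk
      · exact Or.inl ⟨rfl, rfl⟩
      · exact Or.inr ⟨rfl, rfl⟩
      · exact absurd rfl hjk
    · rintro (⟨rfl, rfl⟩ | ⟨rfl, rfl⟩)
      · exact ⟨hpq, Or.inl rfl, Or.inr rfl⟩
      · exact ⟨fun h => hpq h.symm, Or.inr rfl, Or.inl rfl⟩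

/-- The event *detected* between two configurations: the unordered pairs of distinct particles
whose velocities both changed. Between two close sampling times of a hard-sphere trajectory
this is the colliding pair (one collision in between) or nothing (no collision). [folklore] -/
def detectedEvent (z z' : Config N d X) : Finset (Sym2 (Fin N)) :=
  distinctPairs (velChanged z z')

/-- The level-`n` *sampled events* of the curve `γ` on `[s, t]`: the events detected between
consecutive points of the dyadic grid, in increasing time. [folklore] -/
def dyadicEvents (γ : ℝ → Config N d X) (s t : ℝ) (n : ℕ) : List (Finset (Sym2 (Fin N))) :=
  (List.finRange (2 ^ n)).map fun k : Fin (2 ^ n) =>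
    detectedEvent (γ (dyadicSamplePt s t n k)) (γ (dyadicSamplePt s t n ((k : ℕ) + 1)))

/-- The level-`n` *sampled backward sweep* of the tagged particle `i`: the backward sweep over
the sampled events. [folklore] -/
def dyadicSweep (γ : ℝ → Config N d X) (i : Fin N) (s t : ℝ) (n : ℕ) : Finset (Fin N) × ℕ :=
  sweep (dyadicEvents γ s t n) ({i}, 0)

end Detect

/-! ## The sampled sweep is eventually the backward sweep -/

section Sampling

variable [TopologicalSpace X] {G : Geometry d X} {ε : ℝ} {γ : ℝ → Config N d X} {s t : ℝ}

/-- **Fine sampling recovers the collision record.** If the level-`n` mesh separates the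
collision times of a hard-sphere trajectory in `(s, t]`, the nonempty sampled events, in
order, are exactly the collision events. [folklore] -/
theorem _root_.Literature.Analysis.FluidPDE.IsHardSphereTrajectory.dyadicEvents_filter_eq
    (h : IsHardSphereTrajectory G ε N γ) (hst : s < t) {n : ℕ}
    (hsep : ∀ τ ∈ collisionWindow G ε γ s t, ∀ τ' ∈ collisionWindow G ε γ s t,
      τ ≠ τ' → (t - s) / 2 ^ n < |τ - τ'|) :
    (dyadicEvents γ s t n).filter (fun E => E ≠ ∅) = collisionEvents G ε γ s t := by
  classical
  set W := collisionWindow G ε γ s t with hW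
  -- the cells
  have hcell : ∀ k : ℕ, dyadicSamplePt s t n (k + 1) = dyadicSamplePt s t n k + (t - s) / 2 ^ n :=
    dyadicSamplePt_succ
  have hWmem : ∀ τ, τ ∈ W ↔ τ ∈ collisionTimes G ε γ ∧ τ ∈ Ioc s t := fun τ =>
    h.mem_collisionWindow
  have hsub : ∀ k : Fin (2 ^ n),
      Ioc (dyadicSamplePt s t n k) (dyadicSamplePt s t n ((k : ℕ) + 1)) ⊆ Ioc s t := fun k σ hσ =>
    ⟨(le_dyadicSamplePt hst.le _).trans_lt hσ.1, hσ.2.trans (dyadicSamplePt_le hst.le k.2)⟩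
  -- at most one collision time per cell
  have huniq : ∀ (k : ℕ) (τ τ' : ℝ), τ ∈ W → τ' ∈ W →
      τ ∈ Ioc (dyadicSamplePt s t n k) (dyadicSamplePt s t n (k + 1)) →
      τ' ∈ Ioc (dyadicSamplePt s t n k) (dyadicSamplePt s t n (k + 1)) → τ = τ' := by
    intro k τ τ' hτ hτ' h1 h2
    by_contra hne
    rw [hcell] at h1 h2
    exact (abs_sub_lt_of_mem_Ioc h1 h2).not_gt (hsep τ hτ τ' hτ' hne)
  -- occupied cells and their collision time
  let occ : Fin (2 ^ n) → Prop := fun k =>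
    ∃ τ ∈ W, τ ∈ Ioc (dyadicSamplePt s t n k) (dyadicSamplePt s t n ((k : ℕ) + 1))
  let g : Fin (2 ^ n) → ℝ := fun k => if hk : occ k then hk.choose else 0
  have hg : ∀ k, occ k →
      g k ∈ W ∧ g k ∈ Ioc (dyadicSamplePt s t n k) (dyadicSamplePt s t n ((k : ℕ) + 1)) := by
    intro k hk
    simp only [g, dif_pos hk]
    exact hk.choose_spec
  -- an unoccupied cell detects nothing
  have hempty : ∀ k : Fin (2 ^ n), ¬ occ k →
      detectedEvent (γ (dyadicSamplePt s t n k)) (γ (dyadicSamplePt s t n ((k : ℕ) + 1))) = ∅ := by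
    intro k hk
    have hfree : ∀ σ ∈ Ioc (dyadicSamplePt s t n k) (dyadicSamplePt s t n ((k : ℕ) + 1)),
        σ ∉ collisionTimes G ε γ := fun σ hσ hcol =>
      hk ⟨σ, (hWmem σ).2 ⟨hcol, hsub k hσ⟩, hσ⟩
    have hD :
        velChanged (γ (dyadicSamplePt s t n k)) (γ (dyadicSamplePt s t n ((k : ℕ) + 1))) = ∅ := by
      refine Finset.eq_empty_of_forall_notMem fun j hj => mem_velChanged.1 hj ?_
      exact (h.vel_eq_of_free (dyadicSamplePt_mono hst.le (Nat.le_succ _)) hfree j).symm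
    rw [detectedEvent, hD, distinctPairs_empty]
  -- an occupied cell detects the event of its collision, which is nonempty
  have hocc : ∀ k : Fin (2 ^ n), occ k →
      detectedEvent (γ (dyadicSamplePt s t n k)) (γ (dyadicSamplePt s t n ((k : ℕ) + 1))) =
        contactPairSet G ε (γ (g k)) ∧ contactPairSet G ε (γ (g k)) ≠ ∅ := by
    intro k hk
    obtain ⟨hgW, hgI⟩ := hg k hk
    obtain ⟨p, q, hpq, hc⟩ := mem_collisionTimes.1 ((hWmem _).1 hgW).1
    have hfree₁ : ∀ σ ∈ Ioo (dyadicSamplePt s t n k) (g k), σ ∉ collisionTimes G ε γ := by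
      intro σ hσ hcol
      have hσI : σ ∈ Ioc (dyadicSamplePt s t n k) (dyadicSamplePt s t n ((k : ℕ) + 1)) :=
        ⟨hσ.1, hσ.2.le.trans hgI.2⟩
      exact hσ.2.ne (huniq k σ (g k) ((hWmem σ).2 ⟨hcol, hsub k hσI⟩) hgW hσI hgI)
    have hfree₂ : ∀ σ ∈ Ioc (g k) (dyadicSamplePt s t n ((k : ℕ) + 1)),
        σ ∉ collisionTimes G ε γ := by
      intro σ hσ hcol
      have hσI : σ ∈ Ioc (dyadicSamplePt s t n k) (dyadicSamplePt s t n ((k : ℕ) + 1)) :=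
        ⟨hgI.1.trans hσ.1, hσ.2⟩
      exact hσ.1.ne' (huniq k σ (g k) ((hWmem σ).2 ⟨hcol, hsub k hσI⟩) hgW hσI hgI)
    have hD : velChanged (γ (dyadicSamplePt s t n k)) (γ (dyadicSamplePt s t n ((k : ℕ) + 1))) =
        {p, q} := by
      ext j
      rw [mem_velChanged, Finset.mem_insert, Finset.mem_singleton]
      exact h.vel_ne_iff_of_collision hgI.1 hgI.2 hfree₁ hfree₂ hpq hc j
    rw [detectedEvent, hD, distinctPairs_pair hpq, h.contactPairSet_eq_singleton hpq hc]
    exact ⟨rfl, Finset.singleton_ne_empty _⟩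
  -- hence the nonempty sampled events are the events of the occupied cells, in order
  have hfilter : (dyadicEvents γ s t n).filter (fun E => E ≠ ∅) =
      (((List.finRange (2 ^ n)).filter fun k => occ k).map g).map
        fun τ => contactPairSet G ε (γ τ) := by
    rw [dyadicEvents, List.filter_map, List.map_map]
    have hfc : (List.finRange (2 ^ n)).filter
        ((fun E : Finset (Sym2 (Fin N)) => decide (E ≠ ∅)) ∘ fun k : Fin (2 ^ n) =>
          detectedEvent (γ (dyadicSamplePt s t n k)) (γ (dyadicSamplePt s t n ((k : ℕ) + 1)))) =
        (List.finRange (2 ^ n)).filter fun k => decide (occ k) := by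
      refine List.filter_congr fun k _ => ?_
      simp only [Function.comp_apply, decide_eq_decide]
      constructor
      · intro hne
        by_contra hk
        exact hne (hempty k hk)
      · intro hk
        rw [(hocc k hk).1]
        exact (hocc k hk).2
    rw [hfc]
    refine List.map_congr_left fun k hk => ?_
    have hok : occ k := by simpa using (List.mem_filter.1 hk).2
    simp only [Function.comp_apply, (hocc k hok).1]
  -- and the occupied cells enumerate the collision window increasingly
  have hsorted : ((List.finRange (2 ^ n)).filter fun k => occ k).map g = W.sort := by
    apply List.SortedLT.eq_of_mem_iff
    · rw [List.sortedLT_iff_pairwise, List.pairwise_map]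
      refine List.Pairwise.imp_of_mem ?_ ((List.sortedLT_finRange (2 ^ n)).pairwise.filter _)
      intro k k' hk hk' hlt
      have hok : occ k := by simpa using (List.mem_filter.1 hk).2
      have hok' : occ k' := by simpa using (List.mem_filter.1 hk').2
      calc g k ≤ dyadicSamplePt s t n ((k : ℕ) + 1) := (hg k hok).2.2
        _ ≤ dyadicSamplePt s t n k' :=
          dyadicSamplePt_mono hst.le (Nat.succ_le_of_lt (Fin.lt_def.1 hlt))
        _ < g k' := (hg k' hok').2.1
    · exact Finset.sortedLT_sort W
    · intro τ
      rw [List.mem_map, Finset.mem_sort]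
      constructor
      · rintro ⟨k, hk, rfl⟩
        exact (hg k (by simpa using (List.mem_filter.1 hk).2)).1
      · intro hτ
        obtain ⟨k, hk, hτI⟩ := exists_mem_Ioc_dyadicSamplePt hst ((hWmem τ).1 hτ).2 n
        have hok : occ ⟨k, hk⟩ := ⟨τ, hτ, hτI⟩
        refine ⟨⟨k, hk⟩, List.mem_filter.2 ⟨List.mem_finRange _, by simpa using hok⟩, ?_⟩
        obtain ⟨hgW, hgI⟩ := hg ⟨k, hk⟩ hok
        exact huniq k _ _ hgW hτ hgI hτI
  rw [hfilter, hsorted, collisionEvents]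

/-- **The sampled sweep is eventually exact.** Along a hard-sphere trajectory, for every fine
enough dyadic level the sampled backward sweep over `(s, t]` is the backward sweep (the
collision times in the window are finitely many, hence separated by some positive gap).
[folklore] -/
theorem _root_.Literature.Analysis.FluidPDE.IsHardSphereTrajectory.eventually_dyadicSweep_eq
    (h : IsHardSphereTrajectory G ε N γ) (hst : s < t) (i : Fin N) :
    ∀ᶠ n in atTop, dyadicSweep γ i s t n = backwardSweep G ε γ i s t := by
  have htend : Tendsto (fun n : ℕ => (t - s) / (2 : ℝ) ^ n) atTop (𝓝 0) :=
    (tendsto_pow_atTop_atTop_of_one_lt one_lt_two).const_div_atTop (t - s)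
  have hsep : ∀ᶠ n : ℕ in atTop, ∀ τ ∈ collisionWindow G ε γ s t,
      ∀ τ' ∈ collisionWindow G ε γ s t, τ ≠ τ' → (t - s) / 2 ^ n < |τ - τ'| := by
    simp only [eventually_all_finset, eventually_imp_distrib_left]
    intro τ _ τ' _ hne
    exact htend.eventually (eventually_lt_nhds (abs_pos.2 (sub_ne_zero.2 hne)))
  filter_upwards [hsep] with n hn
  rw [dyadicSweep, backwardSweep, ← h.dyadicEvents_filter_eq hst hn, sweep_filter_ne_empty]

end Sampling

/-! ## Measurability along the hard-sphere flow -/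

section FlowMeasurable

/-- Fibres through a finite-valued code with measurable fibres are measurable. [folklore] -/
theorem measurableSet_fiber_comp_of_finite {α κ β : Type*} [MeasurableSpace α] [Finite κ]
    {c : α → κ} (hc : ∀ w, MeasurableSet (c ⁻¹' {w})) (g : κ → β) (b : β) :
    MeasurableSet {x | g (c x) = b} := by
  have : {x | g (c x) = b} = ⋃ w ∈ {w | g w = b}, c ⁻¹' {w} := by
    ext x
    simp
  rw [this]
  exact MeasurableSet.biUnion (Set.to_countable _) fun w _ => hc w

/-- Eventual properties along `atTop : Filter ℕ` of measurable properties are measurable.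
[folklore] -/
theorem measurableSet_setOf_eventually_atTop {α : Type*} [MeasurableSpace α] {P : ℕ → α → Prop}
    (hP : ∀ n, MeasurableSet {x | P n x}) : MeasurableSet {x | ∀ᶠ n in atTop, P n x} := by
  have : {x | ∀ᶠ n in atTop, P n x} = ⋃ a : ℕ, ⋂ b : ℕ, {x | a ≤ b → P b x} := by
    ext x
    simp only [mem_setOf_eq, eventually_atTop, mem_iUnion, mem_iInter]
  rw [this]
  refine MeasurableSet.iUnion fun a => MeasurableSet.iInter fun b => ?_
  by_cases hab : a ≤ b
  · simpa [hab] using hP b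
  · simp [hab]

variable [MeasureSpace X] [TopologicalSpace X] {G : Geometry d X} {ε : ℝ}
  (Φ : HardSphereFlow G ε N)

/-- The velocity of a particle at a fixed time is a measurable function of the initial datum.
[folklore] -/
theorem _root_.Literature.Analysis.FluidPDE.HardSphereFlow.measurable_vel_flow (a : ℝ) (j : Fin N) :
    Measurable fun z => (Φ.flow a z j).2 := by
  have h1 : Measurable fun c : Config N d X => (c j).2 := (measurable_pi_apply j).snd
  exact h1.comp (Φ.measurable_flow a)

/-- The set of particles whose velocity changed between two fixed times has measurable fibres
(as a function of the initial datum). [folklore] -/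
theorem _root_.Literature.Analysis.FluidPDE.HardSphereFlow.measurableSet_velChanged_eq
    (a b : ℝ) (B : Finset (Fin N)) :
    MeasurableSet {z | velChanged (Φ.flow a z) (Φ.flow b z) = B} := by
  have hset : {z | velChanged (Φ.flow a z) (Φ.flow b z) = B} =
      ⋂ j : Fin N, {z | (Φ.flow a z j).2 ≠ (Φ.flow b z j).2 ↔ j ∈ B} := by
    ext z
    simp only [Finset.ext_iff, mem_velChanged, mem_setOf_eq, mem_iInter]
  rw [hset]
  refine MeasurableSet.iInter fun j => ?_
  have hm := measurableSet_eq_fun (Φ.measurable_vel_flow a j) (Φ.measurable_vel_flow b j)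
  by_cases hj : j ∈ B
  · simp only [hj, iff_true]
    exact hm.compl
  · simp only [hj, iff_false, not_not]
    exact hm

/-- The level-`n` *velocity-change code* of an initial datum: for each dyadic cell of
`[s, t]`, the particles whose velocity changed across the cell. [folklore] -/
def _root_.Literature.Analysis.FluidPDE.HardSphereFlow.velCode (s t : ℝ) (n : ℕ)
    (z : Config N d X) : Fin (2 ^ n) → Finset (Fin N) :=
  fun k =>
    velChanged (Φ.flow (dyadicSamplePt s t n k) z) (Φ.flow (dyadicSamplePt s t n ((k : ℕ) + 1)) z)

/-- The velocity-change code has measurable fibres. [folklore] -/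
theorem _root_.Literature.Analysis.FluidPDE.HardSphereFlow.measurableSet_velCode_eq
    (s t : ℝ) (n : ℕ) (w : Fin (2 ^ n) → Finset (Fin N)) :
    MeasurableSet {z | Φ.velCode s t n z = w} := by
  have hset : {z | Φ.velCode s t n z = w} = ⋂ k : Fin (2 ^ n),
      {z | velChanged (Φ.flow (dyadicSamplePt s t n k) z)
        (Φ.flow (dyadicSamplePt s t n ((k : ℕ) + 1)) z) = w k} := by
    ext z
    simp only [mem_setOf_eq, mem_iInter, funext_iff, HardSphereFlow.velCode]
  rw [hset]
  exact MeasurableSet.iInter fun k => Φ.measurableSet_velChanged_eq _ _ _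

/-- The sampled sweep along the flow factors through the velocity-change code. [folklore] -/
theorem _root_.Literature.Analysis.FluidPDE.HardSphereFlow.dyadicSweep_flow_eq
    (i : Fin N) (s t : ℝ) (n : ℕ) (z : Config N d X) :
    dyadicSweep (fun τ => Φ.flow τ z) i s t n =
      sweep ((List.finRange (2 ^ n)).map fun k => distinctPairs (Φ.velCode s t n z k))
        ({i}, 0) := by
  rfl

/-- Every function of the sampled sweep along the flow has measurable fibres. [folklore] -/
theorem _root_.Literature.Analysis.FluidPDE.HardSphereFlow.measurableSet_dyadicSweep_fiber
    {β : Type*} (φ : Finset (Fin N) × ℕ → β) (i : Fin N) (s t : ℝ) (n : ℕ) (b : β) :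
    MeasurableSet {z | φ (dyadicSweep (fun τ => Φ.flow τ z) i s t n) = b} :=
  measurableSet_fiber_comp_of_finite (Φ.measurableSet_velCode_eq s t n)
    (fun w => φ (sweep ((List.finRange (2 ^ n)).map fun k => distinctPairs (w k)) ({i}, 0))) b

/-- **Measurability of the backward cluster.** For every set of particles `A`, the initial
data whose tagged particle `i` has backward cluster `A` over `(s, t]` form a measurable set.
(On the good set the cluster is the eventual value of the sampled sweeps, each of which is a
function of finitely many velocity comparisons at fixed times.) [folklore] -/
theorem _root_.Literature.Analysis.FluidPDE.HardSphereFlow.measurableSet_backwardCluster_eq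
    (i : Fin N) (s t : ℝ) (A : Finset (Fin N)) :
    MeasurableSet {z | Φ.backwardCluster i s t z = A} := by
  rcases le_or_gt t s with hts | hst
  · have hconst : ∀ z, Φ.backwardCluster i s t z = ∅ := fun z => by
      by_cases hz : z ∈ Φ.good
      · rw [Φ.backwardCluster_apply hz, backwardCluster_of_le hts]
      · exact Φ.backwardCluster_apply_of_not_mem hz
    by_cases hA : ∅ = A
    · have : {z | Φ.backwardCluster i s t z = A} = univ :=
        eq_univ_of_forall fun z => (hconst z).trans hA
      rw [this]
      exact MeasurableSet.univ
    · have : {z | Φ.backwardCluster i s t z = A} = ∅ :=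
        eq_empty_of_forall_notMem fun z hz => hA ((hconst z).symm.trans hz)
      rw [this]
      exact MeasurableSet.empty
  · have hP : ∀ n, MeasurableSet
        {z | (dyadicSweep (fun τ => Φ.flow τ z) i s t n).1.erase i = A} := fun n =>
      Φ.measurableSet_dyadicSweep_fiber (fun w => w.1.erase i) i s t n A
    have key : {z | Φ.backwardCluster i s t z = A} =
        (Φ.good ∩ {z | ∀ᶠ n in atTop, (dyadicSweep (fun τ => Φ.flow τ z) i s t n).1.erase i = A})
          ∪ (Φ.goodᶜ ∩ {_z | (∅ : Finset (Fin N)) = A}) := by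
      ext z
      simp only [mem_setOf_eq, mem_union, mem_inter_iff, mem_compl_iff]
      by_cases hz : z ∈ Φ.good
      · have hev := (Φ.isTrajectory z hz).eventually_dyadicSweep_eq hst i
        rw [Φ.backwardCluster_apply hz, KineticTheory.backwardCluster]
        simp only [hz, true_and, not_true_eq_false, false_and, or_false]
        constructor
        · intro hA
          exact hev.mono fun n hn => by rw [hn]; exact hA
        · intro hevP
          obtain ⟨n, hn, hPn⟩ := (hev.and hevP).exists
          rw [← hn]
          exact hPn
      · rw [Φ.backwardCluster_apply_of_not_mem hz]
        simp [hz]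
    rw [key]
    refine (Φ.measurableSet_good.inter (measurableSet_setOf_eventually_atTop hP)).union
      (Φ.measurableSet_good.compl.inter ?_)
    by_cases hA : (∅ : Finset (Fin N)) = A
    · simp [hA]
    · simp [hA]

/-- **Measurability of the recollision count** as a function of the initial datum. [folklore] -/
theorem _root_.Literature.Analysis.FluidPDE.HardSphereFlow.measurable_recollisionCount
    (i : Fin N) (s t : ℝ) : Measurable (Φ.recollisionCount i s t) := by
  refine measurable_to_countable' fun r => ?_
  change MeasurableSet {z | Φ.recollisionCount i s t z = r}
  rcases le_or_gt t s with hts | hst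
  · have hconst : ∀ z, Φ.recollisionCount i s t z = 0 := fun z => by
      by_cases hz : z ∈ Φ.good
      · rw [Φ.recollisionCount_apply hz, recollisionCount_of_le hts]
      · exact Φ.recollisionCount_apply_of_not_mem hz
    by_cases hr : 0 = r
    · have : {z | Φ.recollisionCount i s t z = r} = univ :=
        eq_univ_of_forall fun z => (hconst z).trans hr
      rw [this]
      exact MeasurableSet.univ
    · have : {z | Φ.recollisionCount i s t z = r} = ∅ :=
        eq_empty_of_forall_notMem fun z hz => hr ((hconst z).symm.trans hz)
      rw [this]
      exact MeasurableSet.empty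
  · have hP : ∀ n, MeasurableSet
        {z | (dyadicSweep (fun τ => Φ.flow τ z) i s t n).2 = r} := fun n =>
      Φ.measurableSet_dyadicSweep_fiber (fun w => w.2) i s t n r
    have key : {z | Φ.recollisionCount i s t z = r} =
        (Φ.good ∩ {z | ∀ᶠ n in atTop, (dyadicSweep (fun τ => Φ.flow τ z) i s t n).2 = r})
          ∪ (Φ.goodᶜ ∩ {_z | (0 : ℕ) = r}) := by
      ext z
      simp only [mem_setOf_eq, mem_union, mem_inter_iff, mem_compl_iff]
      by_cases hz : z ∈ Φ.good
      · have hev := (Φ.isTrajectory z hz).eventually_dyadicSweep_eq hst i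
        rw [Φ.recollisionCount_apply hz, KineticTheory.recollisionCount]
        simp only [hz, true_and, not_true_eq_false, false_and, or_false]
        constructor
        · intro hr
          exact hev.mono fun n hn => by rw [hn]; exact hr
        · intro hevP
          obtain ⟨n, hn, hPn⟩ := (hev.and hevP).exists
          rw [← hn]
          exact hPn
      · rw [Φ.recollisionCount_apply_of_not_mem hz]
        simp [hz]
    rw [key]
    refine (Φ.measurableSet_good.inter (measurableSet_setOf_eventually_atTop hP)).union
      (Φ.measurableSet_good.compl.inter ?_)
    by_cases hr : (0 : ℕ) = r
    · simp [hr]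
    · simp [hr]

/-- Events `{k ∈ BC}` are measurable in the initial datum. [folklore] -/
theorem _root_.Literature.Analysis.FluidPDE.HardSphereFlow.measurableSet_mem_backwardCluster
    (i : Fin N) (s t : ℝ) (k : Fin N) :
    MeasurableSet {z | k ∈ Φ.backwardCluster i s t z} := by
  have : {z | k ∈ Φ.backwardCluster i s t z} =
      ⋃ A ∈ {A : Finset (Fin N) | k ∈ A}, {z | Φ.backwardCluster i s t z = A} := by
    ext z
    simp
  rw [this]
  exact MeasurableSet.biUnion (Set.to_countable _)
    fun A _ => Φ.measurableSet_backwardCluster_eq i s t A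

/-- **Measurability of the cardinality of the backward cluster** `z ↦ |BC(i)|` (the random
variable `K` of APST 2015 §1, whose law `P(K = k)` and mean `⟨K⟩_t` are the objects of
APST 2015 Thm 3.1 and PS 2021 Thm 2.1). [folklore] -/
theorem _root_.Literature.Analysis.FluidPDE.HardSphereFlow.measurable_card_backwardCluster
    (i : Fin N) (s t : ℝ) : Measurable fun z => (Φ.backwardCluster i s t z).card := by
  refine measurable_to_countable' fun c => ?_
  have : (fun z => (Φ.backwardCluster i s t z).card) ⁻¹' {c} =
      ⋃ A ∈ {A : Finset (Fin N) | A.card = c}, {z | Φ.backwardCluster i s t z = A} := by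
    ext z
    simp
  rw [this]
  exact MeasurableSet.biUnion (Set.to_countable _)
    fun A _ => Φ.measurableSet_backwardCluster_eq i s t A

/-- The cluster cardinality is integrable under any finite initial law (it is bounded by
`N - 1`). [folklore] -/
theorem _root_.Literature.Analysis.FluidPDE.HardSphereFlow.integrable_card_backwardCluster
    (P₀ : Measure (Config N d X)) [IsFiniteMeasure P₀] (i : Fin N) (s t : ℝ) :
    Integrable (fun z => ((Φ.backwardCluster i s t z).card : ℝ)) P₀ := by
  have hm : Measurable fun z => ((Φ.backwardCluster i s t z).card : ℝ) :=
    measurable_from_nat.comp (Φ.measurable_card_backwardCluster i s t)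
  refine (integrable_const ((N : ℝ) - 1)).mono' hm.aestronglyMeasurable (ae_of_all _ fun z => ?_)
  rw [Real.norm_eq_abs, abs_of_nonneg (Nat.cast_nonneg _)]
  have hle := Φ.card_backwardCluster_le (i := i) (s := s) (t := t) (z := z)
  have hN : 1 ≤ N := i.pos
  calc ((Φ.backwardCluster i s t z).card : ℝ) ≤ ((N - 1 : ℕ) : ℝ) := Nat.cast_le.2 hle
    _ = N - 1 := by rw [Nat.cast_sub hN, Nat.cast_one]

end FlowMeasurable

end

end Literature.MathematicalPhysics.KineticTheory
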